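import Mathlib
import HarnessLib

/-!
# Bochert's theorem on primitive permutation groups (1889)

Topic `Literature/GroupTheory/PermutationGroups`.  Fully PROVED classical results (no named facts):

* `isThreeCycle_commutator_of_support_inter` — if the supports of two permutations meet in exactly
  one point `a`, their commutator is the 3-cycle `(a, x a, y a)` [folklore; the computation behind
  Jordan's and Bochert's theorems].
* `Bochert.exists_base_two_mul_card_le` — **Bochert 1889**: a primitive permutation group of finite
  degree `n` not containing the alternating group has a base of size at most `n / 2`
  (proof as in Burness, *Topics in permutation group theory*, Thm 5.6: a minimal base larger than
  `n/2` yields two group elements whose supports meet in one point, hence a 3-cycle, hence `Aₙ ≤ G`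
  by Jordan's theorem `Equiv.Perm.alternatingGroup_le_of_isPreprimitive_of_isThreeCycle_mem`).
* `card_le_descFactorial_of_base` — a base `B` gives `|G| ≤ n (n-1) ⋯ (n - |B| + 1)`.
* `Bochert.card_le_descFactorial` — hence `|G| ≤ n.descFactorial (n / 2)`, and
  `Bochert.factorial_half_le_index` — the index form `⌊(n+1)/2⌋! ≤ |Sₙ : G|` quoted by
  Maróti 2002 §1 / Dixon–Mortimer Thm 3.3B (this is the statement of the named fact
  `Literature.GroupTheory.PermutationGroups.Bochert1889_index` in `PrimitiveGroupOrder.lean`).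

"Base" is not introduced as a definition: we say `∀ g ∈ G, (∀ b ∈ B, g b = b) → g = 1` inline.
-/

namespace Literature.GroupTheory.PermutationGroups

open Equiv Equiv.Perm MulAction

/-- `f (f⁻¹ w) = w` for permutations (pointwise form). [folklore] -/
theorem perm_apply_inv_self {β : Type*} (f : Perm β) (w : β) : f (f⁻¹ w) = w :=
  f.apply_symm_apply w

/-- `f⁻¹ (f w) = w` for permutations (pointwise form). [folklore] -/
theorem perm_inv_apply_self {β : Type*} (f : Perm β) (w : β) : f⁻¹ (f w) = w :=
  f.symm_apply_apply w

variable {α : Type*} [Fintype α] [DecidableEq α]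

/-- If the supports of two permutations `x`, `y` meet in exactly one point `a`, then the
commutator `x y x⁻¹ y⁻¹` is the 3-cycle `a ↦ x a ↦ y a ↦ a`, written as a product of two
transpositions through `a`. [folklore] -/
theorem commutator_eq_swap_mul_swap_of_support_inter {x y : Perm α} {a : α}
    (h : x.support ∩ y.support = {a}) :
    x * y * x⁻¹ * y⁻¹ = swap a (y a) * swap a (x a) := by
  have ha : a ∈ x.support ∧ a ∈ y.support := by
    have : a ∈ x.support ∩ y.support := by rw [h]; exact Finset.mem_singleton_self a
    simpa [Finset.mem_inter] using this
  have huniq : ∀ z, z ∈ x.support → z ∈ y.support → z = a := by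
    intro z hzx hzy
    have hz : z ∈ x.support ∩ y.support := Finset.mem_inter.mpr ⟨hzx, hzy⟩
    rw [h] at hz
    exact Finset.mem_singleton.mp hz
  have hxa : x a ≠ a := mem_support.mp ha.1
  have hya : y a ≠ a := mem_support.mp ha.2
  have hxa_y : x a ∉ y.support := fun hy => hxa (huniq _ (apply_mem_support.mpr ha.1) hy)
  have hya_x : y a ∉ x.support := fun hx => hya (huniq _ hx (apply_mem_support.mpr ha.2))
  have hxya : x a ≠ y a := fun he => hxa_y (he ▸ apply_mem_support.mpr ha.2)
  -- fixed points
  have hxfix : ∀ w, w ∉ x.support → x w = w := fun w hw => notMem_support.mp hw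
  have hyfix : ∀ w, w ∉ y.support → y w = w := fun w hw => notMem_support.mp hw
  have hxifix : ∀ w, w ∉ x.support → x⁻¹ w = w := fun w hw => by
    rw [inv_eq_iff_eq]; exact (hxfix w hw).symm
  have hyifix : ∀ w, w ∉ y.support → y⁻¹ w = w := fun w hw => by
    rw [inv_eq_iff_eq]; exact (hyfix w hw).symm
  -- the preimages of `a`
  have hxia : x⁻¹ a ∈ x.support := by
    have : x⁻¹ a ∈ x⁻¹.support := apply_mem_support.mpr (by rw [support_inv]; exact ha.1)
    rwa [support_inv] at this
  have hyia : y⁻¹ a ∈ y.support := by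
    have : y⁻¹ a ∈ y⁻¹.support := apply_mem_support.mpr (by rw [support_inv]; exact ha.2)
    rwa [support_inv] at this
  have hxia_y : x⁻¹ a ∉ y.support := by
    intro hy
    have := huniq _ hxia hy
    rw [inv_eq_iff_eq] at this
    exact hxa this.symm
  have hyia_x : y⁻¹ a ∉ x.support := by
    intro hx
    have := huniq _ hx hyia
    rw [inv_eq_iff_eq] at this
    exact hya this.symm
  ext z
  simp only [Perm.coe_mul, Function.comp_apply]
  by_cases h1 : z = a
  · subst h1
    rw [hxifix _ hyia_x, perm_apply_inv_self, swap_apply_left,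
      swap_apply_of_ne_of_ne hxa hxya]
  by_cases h2 : z = x a
  · subst h2
    rw [hyifix _ hxa_y, perm_inv_apply_self, hxfix _ hya_x, swap_apply_right, swap_apply_left]
  by_cases h3 : z = y a
  · subst h3
    rw [perm_inv_apply_self, hyfix _ hxia_y, perm_apply_inv_self,
      swap_apply_of_ne_of_ne hya (Ne.symm hxya), swap_apply_right]
  -- remaining points are fixed by both sides
  rw [swap_apply_of_ne_of_ne h1 h2, swap_apply_of_ne_of_ne h1 h3]
  by_cases hzy : z ∈ y.support
  · have hzx : z ∉ x.support := fun hzx => h1 (huniq _ hzx hzy)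
    have hw : y⁻¹ z ∈ y.support := by
      have : y⁻¹ z ∈ y⁻¹.support := apply_mem_support.mpr (by rw [support_inv]; exact hzy)
      rwa [support_inv] at this
    have hwa : y⁻¹ z ≠ a := by
      intro he; rw [inv_eq_iff_eq] at he; exact h3 he
    have hwx : y⁻¹ z ∉ x.support := fun hwx => hwa (huniq _ hwx hw)
    rw [hxifix _ hwx, perm_apply_inv_self, hxfix _ hzx]
  · by_cases hzx : z ∈ x.support
    · have hw : x⁻¹ z ∈ x.support := by
        have : x⁻¹ z ∈ x⁻¹.support := apply_mem_support.mpr (by rw [support_inv]; exact hzx)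
        rwa [support_inv] at this
      have hwa : x⁻¹ z ≠ a := by
        intro he; rw [inv_eq_iff_eq] at he; exact h2 he
      have hwy : x⁻¹ z ∉ y.support := fun hwy => hwa (huniq _ hw hwy)
      rw [hyifix _ hzy, hyfix _ hwy, perm_apply_inv_self]
    · rw [hyifix _ hzy, hxifix _ hzx, hyfix _ hzy, hxfix _ hzx]

/-- If the supports of two permutations meet in exactly one point, their commutator is a
3-cycle. [folklore] -/
theorem isThreeCycle_commutator_of_support_inter {x y : Perm α} {a : α}
    (h : x.support ∩ y.support = {a}) : (x * y * x⁻¹ * y⁻¹).IsThreeCycle := by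
  have ha : a ∈ x.support ∧ a ∈ y.support := by
    have : a ∈ x.support ∩ y.support := by rw [h]; exact Finset.mem_singleton_self a
    simpa [Finset.mem_inter] using this
  have huniq : ∀ z, z ∈ x.support → z ∈ y.support → z = a := by
    intro z hzx hzy
    have hz : z ∈ x.support ∩ y.support := Finset.mem_inter.mpr ⟨hzx, hzy⟩
    rw [h] at hz
    exact Finset.mem_singleton.mp hz
  have hxa : x a ≠ a := mem_support.mp ha.1
  have hya : y a ≠ a := mem_support.mp ha.2
  have hxa_y : x a ∉ y.support := fun hy => hxa (huniq _ (apply_mem_support.mpr ha.1) hy)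
  have hxya : x a ≠ y a := fun he => hxa_y (he ▸ apply_mem_support.mpr ha.2)
  rw [commutator_eq_swap_mul_swap_of_support_inter h]
  exact isThreeCycle_swap_mul_swap_same (Ne.symm hya) (Ne.symm hxa) (Ne.symm hxya)

omit [DecidableEq α] in
/-- The order of a permutation group is at most `n (n-1) ⋯ (n-b+1)` when some `b`-set `B` is a
base (only the identity fixes `B` pointwise): restriction to `B` is injective. [folklore] -/
theorem card_le_descFactorial_of_base (G : Subgroup (Perm α)) (B : Finset α)
    (hB : ∀ g ∈ G, (∀ b ∈ B, g b = b) → g = 1) :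
    Nat.card G ≤ (Fintype.card α).descFactorial B.card := by
  classical
  let f : G → (B ↪ α) := fun g =>
    ⟨fun b => (g : Perm α) b, fun b₁ b₂ hb => Subtype.ext ((g : Perm α).injective hb)⟩
  have hf : Function.Injective f := by
    intro g₁ g₂ hfg
    have key : ((g₂ : Perm α)⁻¹ * (g₁ : Perm α)) = 1 := by
      refine hB _ (G.mul_mem (G.inv_mem g₂.2) g₁.2) ?_
      intro b hb
      have : (g₁ : Perm α) b = (g₂ : Perm α) b := by
        have := congrArg (fun e => e ⟨b, hb⟩) hfg
        simpa [f] using this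
      rw [Perm.coe_mul, Function.comp_apply, this, perm_inv_apply_self]
    have : (g₁ : Perm α) = g₂ := by
      rw [inv_mul_eq_one] at key
      exact key.symm
    exact Subtype.ext this
  have h1 : Nat.card G ≤ Nat.card (B ↪ α) := Nat.card_le_card_of_injective f hf
  have h2 : Nat.card (B ↪ α) = (Fintype.card α).descFactorial B.card := by
    rw [Nat.card_eq_fintype_card, Fintype.card_embedding_eq, Fintype.card_coe]
  rwa [h2] at h1

/-- `Nat.descFactorial n` is monotone in its second argument on `[0, n]`. [folklore] -/
theorem descFactorial_le_descFactorial_of_le {n k m : ℕ} (hkm : k ≤ m) (hmn : m ≤ n) :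
    n.descFactorial k ≤ n.descFactorial m := by
  induction m, hkm using Nat.le_induction with
  | base => exact le_rfl
  | succ m hkm ih =>
    calc n.descFactorial k ≤ n.descFactorial m := ih (Nat.le_of_succ_le hmn)
      _ ≤ (n - m) * n.descFactorial m := Nat.le_mul_of_pos_left _ (by omega)
      _ = n.descFactorial (m + 1) := (Nat.descFactorial_succ n m).symm

namespace Bochert

/-- **Bochert's theorem (1889)**, base form: a primitive permutation group of finite degree `n`
which does not contain the alternating group has a base `B` with `2 |B| ≤ n`.
Proof following Burness, *Topics in permutation group theory* (2014 notes), Thm 5.6.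
[cite: Bochert1889, main theorem (base form b(G) ≤ n/2 as in Burness's notes Thm 5.6; index form quoted in Maroti2002 §1)] -/
theorem exists_base_two_mul_card_le (G : Subgroup (Perm α)) (hG : IsPreprimitive G α)
    (hA : ¬ alternatingGroup α ≤ G) :
    ∃ B : Finset α, 2 * B.card ≤ Fintype.card α ∧ ∀ g ∈ G, (∀ b ∈ B, g b = b) → g = 1 := by
  classical
  -- the set of bases, as finsets
  set S : Finset (Finset α) := Finset.univ.filter (fun B => ∀ g ∈ G, (∀ b ∈ B, g b = b) → g = 1)
    with hS
  have hmemS : ∀ B, B ∈ S ↔ ∀ g ∈ G, (∀ b ∈ B, g b = b) → g = 1 := by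
    intro B; simp [hS]
  have hSne : S.Nonempty := ⟨Finset.univ, (hmemS _).mpr fun g _ hg => Equiv.ext fun b => hg b
    (Finset.mem_univ b)⟩
  obtain ⟨B, hBS, hBmin⟩ := Finset.exists_min_image S Finset.card hSne
  have hB := (hmemS B).mp hBS
  refine ⟨B, ?_, hB⟩
  by_contra hlt
  push Not at hlt
  -- the complement `C` of `B` is smaller, hence not a base
  have hCcard : Bᶜ.card < B.card := by
    rw [Finset.card_compl]; omega
  have hCnot : ¬ ∀ g ∈ G, (∀ b ∈ Bᶜ, g b = b) → g = 1 := by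
    intro hC
    exact absurd (hBmin _ ((hmemS _).mpr hC)) (not_le.mpr hCcard)
  push Not at hCnot
  obtain ⟨x, hxG, hxC, hx1⟩ := hCnot
  -- `supp x ⊆ B`; pick `a ∈ supp x`
  have hxsupp : ∀ z, z ∈ x.support → z ∈ B := by
    intro z hz
    by_contra hzB
    exact (mem_support.mp hz) (hxC z (Finset.mem_compl.mpr hzB))
  obtain ⟨a, ha⟩ : x.support.Nonempty := by
    rw [Finset.nonempty_iff_ne_empty, Ne, support_eq_empty_iff]; exact hx1
  have haB : a ∈ B := hxsupp a ha
  -- `B.erase a` is smaller, hence not a base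
  have hB'not : ¬ ∀ g ∈ G, (∀ b ∈ B.erase a, g b = b) → g = 1 := by
    intro hB'
    have := hBmin _ ((hmemS _).mpr hB')
    rw [Finset.card_erase_of_mem haB] at this
    have hpos : 0 < B.card := Finset.card_pos.mpr ⟨a, haB⟩
    omega
  push Not at hB'not
  obtain ⟨y, hyG, hyB', hy1⟩ := hB'not
  -- `y` moves `a` (else it would fix `B`, hence be trivial)
  have hya : a ∈ y.support := by
    rw [mem_support]
    intro hya
    apply hy1 (hB y hyG ?_)
    intro b hb
    by_cases hba : b = a
    · rw [hba]; exact hya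
    · exact hyB' b (Finset.mem_erase.mpr ⟨hba, hb⟩)
  -- the supports meet exactly in `a`
  have hint : x.support ∩ y.support = {a} := by
    ext z
    simp only [Finset.mem_inter, Finset.mem_singleton]
    constructor
    · rintro ⟨hzx, hzy⟩
      by_contra hza
      exact (mem_support.mp hzy) (hyB' z (Finset.mem_erase.mpr ⟨hza, hxsupp z hzx⟩))
    · rintro rfl; exact ⟨ha, hya⟩
  have h3 : (x * y * x⁻¹ * y⁻¹).IsThreeCycle := isThreeCycle_commutator_of_support_inter hint
  have hmem : x * y * x⁻¹ * y⁻¹ ∈ G :=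
    G.mul_mem (G.mul_mem (G.mul_mem hxG hyG) (G.inv_mem hxG)) (G.inv_mem hyG)
  exact hA (alternatingGroup_le_of_isPreprimitive_of_isThreeCycle_mem hG h3 hmem)

/-- **Bochert's theorem (1889)**, order form: a primitive permutation group of degree `n` not
containing `Aₙ` has order at most `n (n-1) ⋯ (n - ⌊n/2⌋ + 1) = n.descFactorial (n / 2)`.
[cite: Bochert1889, main theorem (order form; cf. Burness's notes Table 3.2 / Thm 5.6)] -/
theorem card_le_descFactorial (G : Subgroup (Perm α)) (hG : IsPreprimitive G α)
    (hA : ¬ alternatingGroup α ≤ G) :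
    Nat.card G ≤ (Fintype.card α).descFactorial (Fintype.card α / 2) := by
  obtain ⟨B, hB2, hB⟩ := exists_base_two_mul_card_le G hG hA
  calc Nat.card G ≤ (Fintype.card α).descFactorial B.card := card_le_descFactorial_of_base G B hB
    _ ≤ (Fintype.card α).descFactorial (Fintype.card α / 2) :=
        descFactorial_le_descFactorial_of_le (by omega) (Nat.div_le_self _ _)

/-- **Bochert's theorem (1889)**, index form as quoted by Maróti 2002 §1 and Dixon–Mortimer
Thm 3.3B: if `G ≤ Sₙ` is primitive and does not contain `Aₙ`, then `⌊(n+1)/2⌋! ≤ |Sₙ : G|`.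
[cite: Bochert1889, main theorem (index form as quoted in Maroti2002 §1: "(Sₙ : G) ≥ [½(n+1)]!")] -/
theorem factorial_half_le_index (G : Subgroup (Perm α)) (hG : IsPreprimitive G α)
    (hA : ¬ alternatingGroup α ≤ G) :
    Nat.factorial ((Fintype.card α + 1) / 2) ≤ G.index := by
  set n := Fintype.card α with hn
  have hcard := card_le_descFactorial G hG hA
  rw [← hn] at hcard
  have hidx : G.index * Nat.card G = n.factorial := by
    rw [Subgroup.index_mul_card, Nat.card_perm, Nat.card_eq_fintype_card]
  have hfac : (n - n / 2).factorial * n.descFactorial (n / 2) = n.factorial :=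
    Nat.factorial_mul_descFactorial (Nat.div_le_self _ _)
  have hsub : n - n / 2 = (n + 1) / 2 := by omega
  rw [← hsub]
  have hpos : 0 < Nat.card G := Nat.card_pos
  -- (n - n/2)! * descFactorial = index * card ≥ ... ; divide through
  by_contra hlt
  push Not at hlt
  have : G.index * Nat.card G < (n - n / 2).factorial * n.descFactorial (n / 2) :=
    calc G.index * Nat.card G < (n - n / 2).factorial * Nat.card G :=
          Nat.mul_lt_mul_of_pos_right hlt hpos
      _ ≤ (n - n / 2).factorial * n.descFactorial (n / 2) := Nat.mul_le_mul_left _ hcard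
  rw [hidx, hfac] at this
  exact lt_irrefl _ this

end Bochert

/-- If `G ≤ Sym(α)` has index `> 2` then `G` does not contain the alternating group. [folklore] -/
theorem not_alternatingGroup_le_of_two_lt_index (G : Subgroup (Perm α)) (h : 2 < G.index) :
    ¬ alternatingGroup α ≤ G := by
  intro hle
  rcases subsingleton_or_nontrivial α with hα | hα
  · -- `Perm α` is trivial, so the index is `1`
    have hdvd : G.index ∣ (Fintype.card α).factorial := by
      have := G.index_dvd_card
      rwa [Nat.card_perm, Nat.card_eq_fintype_card] at this
    rw [(Nat.factorial_eq_one).mpr (Fintype.card_le_one_iff_subsingleton.mpr hα),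
      Nat.dvd_one] at hdvd
    omega
  · have h2 : G.index ∣ 2 := by
      rw [← alternatingGroup.index_eq_two (α := α)]
      exact Subgroup.index_dvd_of_le hle
    have := Nat.le_of_dvd (by norm_num) h2
    omega

end Literature.GroupTheory.PermutationGroups
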